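import Summits.ResolutionOfSingularities.ResolutionOfSingularities.Theorems.FrobeniusLadderFRationalResolutionStrataRegularNhd
import Literature.AlgebraicGeometry.Resolution.RegularSequenceSpread
import Mathlib.Data.Set.List
import Mathlib.Data.List.FinRange
import HarnessLib

/-!
# Crux `FrobeniusLadder.FRationalResolution` (stmt-ResolutionOfSingularities-15317), line `redirect`,
# stub `stub_diagonalizableQuotientResolution` — a PART OF A REGULAR SYSTEM OF PARAMETERS at a prime
# cuts out strict normal crossings strata on a whole Zariski neighbourhood (any field)

Entry point for `…StrataRegularNhd.exists_nhd_forall_sublist` in the currency the log-regular line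
actually holds (`…FixedPointGenerators`: a homogeneous regular system of parameters at a fixed
prime): if the images of `x₁,…,x_n ∈ A` in `A_𝔔` are part of a regular system of parameters
(`IsRsopPart`, tree), then for every sub-list `ys` of `(x₁,…,x_n)` the quotient `A_𝔔/(ys)` is
regular and the images form a weakly regular sequence (Matsumura 14.2/14.3, tree's
`IsRsopPart.isRegularLocalRing_quotient`, `isRegular_of_span_eq_maximalIdeal`), so the
neighbourhood theorem applies:

* `ofList_eq_span_range_get` — bookkeeping; `isRsopPart_get_of_sublist` — a sub-list of an rsop part, read through `List.get`, is an rsop part;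
* `isRegularLocalRing_quotient_ofList_of_sublist`, `isWeaklyRegular_of_sublist` — the two
  hypotheses of the neighbourhood theorem at `𝔔`;
* **`exists_nhd_of_isRsopPart`** — for `A` of finite type over a field: there is `f ∉ 𝔔` such that
  for every prime `𝔔' ∌ f` and every sub-list `ys ⊆ 𝔔'` of `x`, `A_𝔔'/(ys)` is a regular local
  ring, the images of `ys` form an `A_𝔔'`-regular sequence and `dim A_𝔔'/(ys) + |ys| = dim A_𝔔'`
  (the coordinate hyperplanes of `x` form a strict normal crossings configuration on `D(f)`; Kato
  (2.1) for the free chart on `D(f)`).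

Honest label: generic commutative-algebra brick toward the Kato (7.1) step of the census (no stub
closed). No definitions, no named facts, no sorry.
[cite: Matsumura1987, Thms. 14.2, 14.3] [folklore; cite: Kato1994, Prop. (7.1)]
-/

noncomputable section

-- single-problem summit: the doubled namespace component is forced
set_option linter.dupNamespace false

open RingTheory.Sequence IsLocalRing Literature.AlgebraicGeometry.Resolution

namespace Summit.ResolutionOfSingularities.ResolutionOfSingularities.Theorems.FRationalResolution.RsopStrataNhd

universe u

/-- The ideal of a list is the span of the range of its `get`. [folklore] -/
theorem ofList_eq_span_range_get {R : Type u} [CommRing R] (ys : List R) :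
    Ideal.ofList ys = Ideal.span (Set.range fun i : Fin ys.length => ys.get i) := by
  rw [Ideal.ofList]
  congr 1
  exact (Set.range_list_get ys).symm

section Local

variable {R : Type u} [CommRing R] [IsLocalRing R] {n : ℕ} {z : Fin n → R}

/-- A sub-list of (the list of) a part of a regular system of parameters, read as a family
through `List.get`, is again a part of a regular system of parameters. [cite: Matsumura1987, Thm. 14.2] -/
theorem isRsopPart_get_of_sublist (hz : IsRsopPart z) {ys : List R} (hys : ys.Sublist (List.ofFn z)) :
    IsRsopPart (fun i : Fin ys.length => ys.get i) := by
  classical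
  -- every member of `ys` is some `z j`
  have hmem : ∀ i : Fin ys.length, ∃ j, z j = ys.get i := fun i => by
    have h : ys.get i ∈ List.ofFn z := hys.subset (List.get_mem ys i)
    exact (List.mem_ofFn' z _).mp h
  choose ι hι using hmem
  have hnodup : ys.Nodup := hys.nodup (List.nodup_ofFn.mpr hz.injective)
  have hιinj : Function.Injective ι := by
    intro i j hij
    have h : ys.get i = ys.get j := by rw [← hι i, ← hι j, hij]
    exact List.nodup_iff_injective_get.mp hnodup h
  have heq : (fun i : Fin ys.length => ys.get i) = z ∘ ι := funext fun i => (hι i).symm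
  rw [heq]
  exact hz.comp ι hιinj

/-- **Quotients by sub-families of an rsop part are regular.** [cite: Matsumura1987, Thm. 14.2] -/
theorem isRegularLocalRing_quotient_ofList_of_sublist (hz : IsRsopPart z) {ys : List R}
    (hys : ys.Sublist (List.ofFn z)) : IsRegularLocalRing (R ⧸ Ideal.ofList ys) := by
  have h := (isRsopPart_get_of_sublist hz hys).isRegularLocalRing_quotient
  rw [← ofList_eq_span_range_get] at h
  exact h

/-- **Sub-families of an rsop part, in any order, are weakly regular sequences** (they are a prefix
of a full regular system of parameters, which is an `R`-sequence). [cite: Matsumura1987, Thm. 14.3] -/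
theorem isWeaklyRegular_of_sublist (hz : IsRsopPart z) {ys : List R}
    (hys : ys.Sublist (List.ofFn z)) : IsWeaklyRegular R ys := by
  have hz' := isRsopPart_get_of_sublist hz hys
  haveI := hz'.isRegularLocalRing
  obtain ⟨e, x, hrank, hspan, hxz⟩ := hz'.exists_rsop
  have hlen : (List.ofFn x).length = ringKrullDim R := by
    rw [List.length_ofFn, ← IsRegularLocalRing.spanFinrank_maximalIdeal, hrank]
  have hofList : Ideal.ofList (List.ofFn x) = Ideal.span (Set.range x) := by
    rw [Ideal.ofList]
    congr 1
    ext r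
    simp [List.mem_ofFn']
  have hreg := isRegular_of_span_eq_maximalIdeal R (List.ofFn x) (by rw [hofList, hspan]) hlen
  have hw := hreg.toIsWeaklyRegular
  -- `x = (ys, tail)`, so `ofFn x = ys ++ tail`
  have hxeq : x = Fin.append (fun i : Fin ys.length => ys.get i)
      (fun j : Fin e => x (Fin.natAdd ys.length j)) := by
    funext i
    induction i using Fin.addCases with
    | left i => rw [Fin.append_left, hxz]
    | right j => rw [Fin.append_right]
  rw [hxeq, List.ofFn_fin_append] at hw
  have hpre := ((isWeaklyRegular_append_iff R _ _).mp hw).1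
  have hfst : (List.ofFn fun i : Fin ys.length => ys.get i) = ys := List.ofFn_get ys
  rwa [hfst] at hpre

end Local

/-- **A part of a regular system of parameters at `𝔔` gives strict normal crossings strata on a
neighbourhood of `𝔔` (any base field).** Let `A` be of finite type over a field `k`, `𝔔` a prime,
and `x₁,…,x_n ∈ A` whose images in `A_𝔔` are part of a regular system of parameters. Then there is
`f ∉ 𝔔` such that for every prime `𝔔' ∌ f` and every sub-list `ys` of `(x₁,…,x_n)` with `ys ⊆ 𝔔'`:
`A_𝔔'/(ys)A_𝔔'` is a regular local ring, the images of `ys` form an `A_𝔔'`-regular sequence, and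
`dim A_𝔔'/(ys)A_𝔔' + |ys| = dim A_𝔔'`. [cite: Matsumura1987, Thms. 14.2, 14.3]
[folklore; cite: Kato1994, Prop. (7.1)] -/
theorem exists_nhd_of_isRsopPart (k : Type u) [Field k] {A : Type u} [CommRing A] [Algebra k A]
    [Algebra.FiniteType k A] (𝔔 : PrimeSpectrum A) {n : ℕ} (x : Fin n → A)
    (hx : IsRsopPart fun i => algebraMap A (Localization.AtPrime 𝔔.asIdeal) (x i)) :
    ∃ f : A, f ∉ 𝔔.asIdeal ∧ ∀ 𝔔' : PrimeSpectrum A, f ∉ 𝔔'.asIdeal →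
      ∀ ys : List A, ys.Sublist (List.ofFn x) → (∀ y ∈ ys, y ∈ 𝔔'.asIdeal) →
        IsRegularLocalRing (Localization.AtPrime 𝔔'.asIdeal ⧸
            (Ideal.ofList ys).map (algebraMap A (Localization.AtPrime 𝔔'.asIdeal))) ∧
          IsRegular (Localization.AtPrime 𝔔'.asIdeal)
            (ys.map (algebraMap A (Localization.AtPrime 𝔔'.asIdeal))) ∧
          ringKrullDim (Localization.AtPrime 𝔔'.asIdeal ⧸
              (Ideal.ofList ys).map (algebraMap A (Localization.AtPrime 𝔔'.asIdeal))) +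
              ys.length = ringKrullDim (Localization.AtPrime 𝔔'.asIdeal) := by
  set L := Localization.AtPrime 𝔔.asIdeal with hL
  -- a sub-list of `x` maps to a sub-list of the rsop part
  have hmap : ∀ ys : List A, ys.Sublist (List.ofFn x) →
      (ys.map (algebraMap A L)).Sublist (List.ofFn fun i => algebraMap A L (x i)) := by
    intro ys hys
    have h := hys.map (algebraMap A L)
    rwa [List.map_ofFn] at h
  refine StrataRegularNhd.exists_nhd_forall_sublist k 𝔔 (List.ofFn x) ?_ ?_
  · intro ys hys _
    have h := isRegularLocalRing_quotient_ofList_of_sublist hx (hmap ys hys)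
    rwa [← StrataRegularNhd.map_ofList] at h
  · intro ys hys _
    exact isWeaklyRegular_of_sublist hx (hmap ys hys)

end Summit.ResolutionOfSingularities.ResolutionOfSingularities.Theorems.FRationalResolution.RsopStrataNhd

end
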